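import Mathlib
import HarnessLib
import Literature.ModelTheory.FiniteModelTheory.StructCkEquiv
import Summits.ValiantsHypothesis.ValiantsHypothesis.Theorems.SymmetryDialAffinePebble
import Summits.ValiantsHypothesis.ValiantsHypothesis.Theorems.SymmetryDialDisalignedCFI
import Summits.ValiantsHypothesis.ValiantsHypothesis.Theorems.SymmetryDialDisalignedCFIShear
import Summits.ValiantsHypothesis.ValiantsHypothesis.Theorems.SymmetryDialShearStrategy
import Summits.ValiantsHypothesis.ValiantsHypothesis.Theorems.SymmetryDialShearInvariant
import Summits.ValiantsHypothesis.ValiantsHypothesis.Theorems.SymmetryDialShearGame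
import Summits.ValiantsHypothesis.ValiantsHypothesis.Theorems.SymmetryDialCondScheme

/-!
# Symmetry dial — the KEYED protection scheme (NODE-g9 §B.15, lens 1, g9)

§B.15 found that the certifier's scheme `protAsc` (`asc4.py`) makes its own linear re-clearing
condition FAIL at `k = 4` on the `d = 135` designs for DUAL configurations `({p, q}, {b})`: when a
point `o` is pinned next to a pinned point `s` and a dual `b` is pebbled, every small edge set `S`
near `s` whose total coboundary-change functional is `≡ b ⊗ z` modulo the point rows of `s, o` is
FROZEN, so its parity must already be right when the last of `s, o, b` lands.  All such `S` live on
two local figures — the SQUARE `s – x – o – y – s` and, when `s + o` is a generator, the PRISM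
`s – x – w – o` — and are KEYED by `b` = the sum of the end values of `S`.  The repaired scheme
`protKey` = `protAsc` ∪ (for every pinned `p` and pebbled dual `b`, the `o`-side edges of every keyed
`S`), ported verbatim from `asc4k.py` (`DesignK.keyset`), with which the rank certificate passes every
sampled dual configuration again (and is unchanged on point configurations).  As for `protAsc`, the
scheme contains the stars and is empty on the empty board, so the kernel theorem
`SymmetryDialShearGame.affinePebbleEquiv_of_linear'` instantiates: `affinePebbleEquiv_of_condLinKey`.
-/

set_option linter.dupNamespace false

namespace Summit.ValiantsHypothesis.ValiantsHypothesis.Theorems.SymmetryDialKeyedScheme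

open Literature.ModelTheory.FiniteModelTheory
open SymmetryDialAffinePebble (V pair Laff affStr AffinePebbleEquiv)
open SymmetryDialDisalignedCFI (base fib Design cfiMat)
open SymmetryDialDisalignedCFIShear (cobd transp)
open SymmetryDialShearStrategy (ShearParam)
open SymmetryDialShearInvariant (Pos)
open SymmetryDialShearGame (affinePebbleEquiv_of_linear')
open SymmetryDialCondScheme (pinned dualPeb protAsc protAsc_of_pinned_left protAsc_of_pinned_right
  pinned_of_mem pinned_empty protAsc_empty)

variable {d₀ r δ : ℕ}

/-! ## §1 Keys -/

/-- `ε • x` for a Boolean switch. -/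
def sw (ε : Bool) (x : V r) : V r := if ε then x else 0

/-- `Key(p, b) ∋ (v, w)` (`asc4k.DesignK.keyset`), for a pinned base point `p` and a pebbled functional
`b`; `a ≠ c` range over generator labels.  SQUARE (`x = p + g_c`, `y = p + g_a`, `o = x + g_a`): the
edge `(x, o)` is keyed when `b = λ_{x,a} + ε₁ λ_{y,c} + ε₂ λ_{x,c} + ε₃ λ_{y,a}` (the swapped pair
`(c, a)` keys `(y, o)`).  PRISM (`x = p + g_a`, `w = x + g_c`, `o = w + g_a = p + g_c`): the edge
`(w, o)` is keyed when `b = λ_{w,a} + ε₁ (λ_{x,c} + λ_{w,c}) + ε₂ λ_{x,a}`, the rung `(x, w)` when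
`b = (λ_{x,c} + λ_{w,c}) + ε₁ λ_{w,a} + ε₂ λ_{x,a}`. -/
def keyed (D : Design d₀ r δ) (p : V d₀) (b : V r) (v w : V d₀) : Bool :=
  decide (∃ a c : Fin δ, a ≠ c ∧
    ((v = p + D.gen c ∧ w = v + D.gen a ∧ ∃ ε₁ ε₂ ε₃ : Bool,
        b = D.lam v a + sw ε₁ (D.lam (p + D.gen a) c) + sw ε₂ (D.lam v c) + sw ε₃ (D.lam (p + D.gen a) a)) ∨
     (v = p + D.gen a + D.gen c ∧ w = v + D.gen a ∧ ∃ ε₁ ε₂ : Bool,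
        b = D.lam v a + sw ε₁ (D.lam (p + D.gen a) c + D.lam v c) + sw ε₂ (D.lam (p + D.gen a) a)) ∨
     (v = p + D.gen a ∧ w = v + D.gen c ∧ ∃ ε₁ ε₂ : Bool,
        b = (D.lam v c + D.lam w c) + sw ε₁ (D.lam w a) + sw ε₂ (D.lam v a))))

/-! ## §2 The keyed scheme -/

/-- `Prot'` of `asc4k.py`: `protAsc` together with, for every pinned `p` and pebbled dual `b`, the keyed
edges (either orientation). -/
def protKey (k : ℕ) (D : Design d₀ r δ) (s : Pos k (d₀ + r)) (v w : V d₀) : Bool :=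
  protAsc k D s v w ||
    decide (∃ (p : V d₀) (b : V r), pinned s p = true ∧ dualPeb s b = true ∧
      (keyed D p b v w = true ∨ keyed D p b w v = true))

/-- Stars are protected (left end pinned). -/
theorem protKey_of_pinned_left {k : ℕ} (D : Design d₀ r δ) (s : Pos k (d₀ + r)) (v w : V d₀)
    (h : pinned s v = true) : protKey k D s v w = true := by
  unfold protKey; rw [protAsc_of_pinned_left D s v w h]; rfl

/-- Stars are protected (right end pinned). -/
theorem protKey_of_pinned_right {k : ℕ} (D : Design d₀ r δ) (s : Pos k (d₀ + r)) (v w : V d₀)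
    (h : pinned s w = true) : protKey k D s v w = true := by
  unfold protKey; rw [protAsc_of_pinned_right D s v w h]; rfl

/-- Nothing is protected on the empty board. -/
theorem protKey_empty {k : ℕ} (D : Design d₀ r δ) (v w : V d₀) :
    protKey k D (fun _ : Fin k => (none : Option (V (d₀ + r) ⊕ V (d₀ + r)))) v w = false := by
  unfold protKey
  rw [protAsc_empty, Bool.false_or, decide_eq_false_iff_not]
  rintro ⟨p, b, hp, -, -⟩
  rw [pinned_empty] at hp
  exact Bool.false_ne_true hp

/-! ## §3 (S4) for the keyed scheme, modulo its linear condition -/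

/-- **(S4) for the keyed scheme.**  For a Good framed Cayley design, any decoration and SYMMETRIC
twists, `𝔄(cfiMat D S t) ≡_{C^k} 𝔄(cfiMat D S t')` as soon as the linear re-clearing condition of
the scheme `protKey k D` holds (the existence form, over positions, of the repaired certificate
`COND'_k(D)` of `asc4k.py`). -/
theorem affinePebbleEquiv_of_condLinKey {k : ℕ} (D : Design d₀ r δ) (hD : D.Good)
    (S : V d₀ → V r → Bool) (t t' : V d₀ → V d₀ → Fin 2)
    (ht : ∀ v w, t v w = t w v) (ht' : ∀ v w, t' v w = t' w v)
    (hlin : ∀ (s : Pos k (d₀ + r)) (i i₀ : Fin k) (d : V d₀ → V d₀ → Fin 2), (∀ v w, d v w = d w v) →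
      ∃ (ΔL : V d₀ → V r) (Δc : V r),
        (∀ v w, ΔL (v + w) = ΔL v + ΔL w) ∧
        (∀ j, j ≠ i → ∀ x, s j = some (.inl x) → ΔL (base x) + Δc = 0) ∧
        (∀ j, j ≠ i → ∀ ξ, s j = some (.inr ξ) → transp ΔL (fib ξ) = 0) ∧
        (∀ (v : V d₀) (idx : Fin δ), protKey k D (Function.update s i none) v (v + D.gen idx) = true →
          (protKey k D (Function.update s i₀ none) v (v + D.gen idx) = true →
            cobd D (fun u => ΔL u + Δc) v (v + D.gen idx) = 0) ∧
          (¬ protKey k D (Function.update s i₀ none) v (v + D.gen idx) = true →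
            cobd D (fun u => ΔL u + Δc) v (v + D.gen idx) = d v (v + D.gen idx)))) :
    AffinePebbleEquiv k (d₀ + r) (cfiMat D S t) (cfiMat D S t') := by
  refine affinePebbleEquiv_of_linear' D hD S t t' ht ht' (fun s v w => protKey k D s v w = true)
    (fun v w h => ?_) (fun s v w hpin => ?_) hlin
  · rw [protKey_empty] at h; exact Bool.false_ne_true h
  · obtain ⟨j, x, hj, rfl⟩ := hpin
    exact ⟨protKey_of_pinned_left D s _ w (pinned_of_mem s j x hj),
      protKey_of_pinned_right D s w _ (pinned_of_mem s j x hj)⟩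

end Summit.ValiantsHypothesis.ValiantsHypothesis.Theorems.SymmetryDialKeyedScheme
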